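import Literature.Analysis.FluidPDE.StokesTorusPositivityProofs
import Literature.Analysis.FunctionSpaces.TorusSobolevNormProofs
import HarnessLib

/-!
# The domain of the Stokes operator on the flat torus: `D(A) = H ∩ H²` (proof)

`Literature.Analysis.FluidPDE.StokesTorus` defines the Stokes operator `A = Torus.stokesOperator d`
on `L²(T^d; ℝ^d)` from its *weak graph*: `(v, w) ∈ Torus.stokesGraph d` iff `v, w ∈ H`
(`H = Torus.energySpace d`, the `L²` closure of the smooth divergence-free mean-zero fields `𝒱`)
and `⟪w, g⟫ = -⟪v, Δ g⟫` for every `g ∈ 𝒱` (`Torus.IsStokesImage`), and vendors as the named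
fact `Torus.stokesOperator_domain_eq` the description of its domain printed in
Constantin–Foias 1988, Ch. 4, periodic case, (4.35): `D(A) = H_{2,L} ∩ V = H_{2,L} ∩ H`, i.e.
`D(A) = H ∩ H²(T^d; ℝ^d)` (with `L = 1`, `H²` the spectral class `Torus.MemSobolev 2` of the
componentwise complexification). This file **proves** it: `Torus.stokesOperator_domain_eq_holds`.

## Proof

Everything is read off the Fourier coefficients `û(k) = 𝓕(complexify ∘ u)(k) ∈ ℂ^d`
(Constantin–Foias 1988, (4.30)–(4.37): `H = {û(0) = 0, k · û(k) = 0}`, `(A u)_k = 4π²|k|² û_k`).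

* `D(A) ⊆ H ∩ H²`. If `(v, w)` is in the graph then `ŵ(k) = 4π²|k|² v̂(k)` for every `k`
  (`Torus.IsStokesImage.mFourierCoeff_eq`, proved in the sibling `StokesTorusPositivityProofs`
  by testing the graph relation against the single real modes `Re (e_k z)`, `k · z = 0`).
  Then `(1 + |k|²)² ‖v̂(k)‖² ≤ ‖ŵ(k)‖²` termwise (`1 + |k|² ≤ 4π²|k|²` for `k ≠ 0`, and
  `v̂(0) = 0` since `H` is mean zero), so `‖v‖_{H²} ≤ ‖w‖_{H⁰} = ‖w‖_{L²} < ∞` (Parseval,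
  `Torus.memSobolev_zero_complexify`) (`Torus.memSobolev_two_of_mem_stokesGraph`).
* `H ∩ H² ⊆ D(A)`. For `v ∈ H ∩ H²` the family `c_k = 4π²|k|² v̂(k)` is square summable and
  conjugate symmetric; Riesz–Fischer (`Torus.exists_memLp_two_forall_mFourierCoeff_eq_of_summable`)
  gives `f ∈ L²(T^d; ℂ^d)` with `f̂ = c`, and `w = Re f` is a real `L²` field with
  `ŵ(k) = ½ (c_k + conj c_{-k}) = c_k` (`Torus.exists_forall_mFourierCoeff_eq_of_isConjSymm`).
  It lies in `H` by the coefficient criterion `û(0) = 0 ∧ k · û(k) = 0 ⟹ u ∈ H`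
  (`Torus.mem_energySpace_of_mFourierCoeff`: `P u` and `u` have the same coefficients by
  `Torus.mFourierCoeff_lerayProjector_holds`, hence coincide by uniqueness of Fourier
  coefficients, and `P u ∈ H`), and `⟪w, g⟫ = -⟪v, Δ g⟫` for smooth `g` by Parseval for inner
  products (`Torus.hasSum_re_inner_mFourierCoeff_complexify`) and `𝓕(Δ g)(k) = -4π²|k|² ĝ(k)`
  (`Torus.mFourierCoeff_complexify_laplacian`) (`Torus.isStokesImage_of_mFourierCoeff`).

No statement of `StokesTorus` is touched; this file only adds theorems (the siblings
`StokesTorusProofs`, `StokesTorusPositivityProofs`, `StokesTorusCompletenessProofs`,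
`StokesTorusGalerkinDimProofs` discharge other facts of the same statement file; the present one
additionally needs Riesz–Fischer and uniqueness of Fourier coefficients from
`TorusSobolevNormProofs` and is kept apart).

## References

* P. Constantin, C. Foias, *Navier–Stokes Equations*, Univ. Chicago Press (1988), Ch. 4,
  periodic case, (4.30)–(4.40), in particular (4.33) (`H`), (4.35) (`D(A) = H_{2,L} ∩ H`),
  (4.36)–(4.37) (`(Au)_k = 4π²L⁻²|k|² u_k`). [ConstantinFoias1988]
* L. Grafakos, *Classical Fourier Analysis*, 3rd ed. (2014), Prop. 3.2.4 (uniqueness of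
  Fourier coefficients), Prop. 3.2.7 (Parseval, Riesz–Fischer). [Grafakos2014]
-/

noncomputable section

open MeasureTheory Filter UnitAddTorus
open scoped InnerProductSpace RealInnerProductSpace ENNReal

namespace Literature.Analysis.FluidPDE

namespace Torus

variable {d : Type*} [Fintype d] [DecidableEq d]

/-! ## Elementary frequency facts -/

omit [DecidableEq d] in
/-- For a nonzero frequency, `1 + |k|² ≤ λ_k = 4π²|k|²` (since `|k|² ≥ 1`,
`Torus.one_le_freqNormSq`, and `4π² ≥ 2`): the inhomogeneous `H²` weight is dominated by the
Stokes eigenvalue `Torus.stokesEigenvalue k`. [folklore] -/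
theorem one_add_freqNormSq_le_stokesEigenvalue {k : d → ℤ} (hk : k ≠ 0) :
    1 + FunctionSpaces.Torus.freqNormSq k ≤ stokesEigenvalue k := by
  have h1 := one_le_freqNormSq hk
  have hπ : (2 : ℝ) ≤ 4 * Real.pi ^ 2 := by nlinarith [Real.two_le_pi, Real.pi_pos]
  calc 1 + FunctionSpaces.Torus.freqNormSq k
      ≤ 2 * FunctionSpaces.Torus.freqNormSq k := by linarith
    _ ≤ 4 * Real.pi ^ 2 * FunctionSpaces.Torus.freqNormSq k :=
        mul_le_mul_of_nonneg_right hπ (by linarith)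

omit [DecidableEq d] in
/-- The Stokes eigenvalue is at most `4π²` times the inhomogeneous weight:
`λ_k = 4π²|k|² ≤ 4π² (1 + |k|²)`. [folklore] -/
theorem stokesEigenvalue_le_mul_one_add_freqNormSq (k : d → ℤ) :
    stokesEigenvalue k ≤ 4 * Real.pi ^ 2 * (1 + FunctionSpaces.Torus.freqNormSq k) := by
  unfold stokesEigenvalue
  have := FunctionSpaces.Torus.freqNormSq_nonneg k
  nlinarith [Real.pi_pos]

omit [DecidableEq d] in
/-- The order-two Sobolev weight is `⟨k⟩² = 1 + |k|²`. [folklore] -/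
theorem sobolevWeight_two (k : d → ℤ) :
    FunctionSpaces.Torus.sobolevWeight 2 k = 1 + FunctionSpaces.Torus.freqNormSq k := by
  rw [FunctionSpaces.Torus.sobolevWeight, show (2 : ℝ) / 2 = 1 by norm_num, Real.rpow_one]

/-! ## Coefficients of fields in `H` -/

/-- The Fourier coefficients of a field `u ∈ H` are transversal: `∑ⱼ kⱼ û(k)ⱼ = 0`
(`H` is weakly divergence free; Constantin–Foias 1988, (4.33)).
[cite: ConstantinFoias1988, Ch. 4 (4.33)] -/
theorem sum_mul_mFourierCoeff_eq_zero_of_mem_energySpace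
    {u : Lp (EuclideanSpace ℝ d) 2 (volume : Measure (UnitAddTorus d))}
    (hu : u ∈ FunctionSpaces.Torus.energySpace d) (k : d → ℤ) :
    ∑ j, (k j : ℂ) *
      (mFourierCoeff (FunctionSpaces.EuclideanSpace.complexify ∘ ⇑u)) k j = 0 :=
  (isWeaklyDivFree_of_mem_energySpace hu).sum_mul_mFourierCoeff_eq_zero (Lp.memLp u) k

/-- **Coefficient criterion for `H`**: an `L²` field whose zero mode vanishes and whose other
coefficients are transversal lies in `H` (Constantin–Foias 1988, (4.33):
`H = {u | u_0 = 0, ⟨u_k, k⟩ = 0}`). Proof: by `Torus.mFourierCoeff_lerayProjector_holds` the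
Leray projection `P u ∈ H` has the same Fourier coefficients as `u`, so `P u = u` a.e. by
uniqueness of Fourier coefficients (`Torus.ae_eq_of_forall_mFourierCoeff_eq`).
[cite: ConstantinFoias1988, Ch. 4 (4.33)] -/
theorem mem_energySpace_of_mFourierCoeff
    {u : Lp (EuclideanSpace ℝ d) 2 (volume : Measure (UnitAddTorus d))}
    (h0 : mFourierCoeff (FunctionSpaces.EuclideanSpace.complexify ∘ ⇑u) 0 = 0)
    (hk : ∀ k : d → ℤ,
      ∑ j, (k j : ℂ) * mFourierCoeff (FunctionSpaces.EuclideanSpace.complexify ∘ ⇑u) k j = 0) :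
    u ∈ FunctionSpaces.Torus.energySpace d := by
  have hcoeff : ∀ k,
      mFourierCoeff (FunctionSpaces.EuclideanSpace.complexify ∘ ⇑(lerayProjector d u)) k =
        mFourierCoeff (FunctionSpaces.EuclideanSpace.complexify ∘ ⇑u) k := fun k => by
    rw [mFourierCoeff_lerayProjector_apply u k]
    by_cases hk0 : k = 0
    · subst hk0
      rw [lerayCoeff_zero, h0]
    · rw [lerayCoeff_of_ne_zero hk0, leraySym_of_transversal (hk k)]
  have hPi : Integrable (FunctionSpaces.EuclideanSpace.complexify ∘ ⇑(lerayProjector d u)) volume :=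
    FunctionSpaces.Torus.integrable_complexify_comp ((Lp.memLp _).integrable one_le_two)
  have hui : Integrable (FunctionSpaces.EuclideanSpace.complexify ∘ ⇑u) volume :=
    FunctionSpaces.Torus.integrable_complexify_comp ((Lp.memLp _).integrable one_le_two)
  have hae := FunctionSpaces.Torus.ae_eq_of_forall_mFourierCoeff_eq hPi hui hcoeff
  have hae' : ⇑(lerayProjector d u) =ᵐ[volume] ⇑u :=
    hae.mono fun x hx => FunctionSpaces.EuclideanSpace.complexify_injective hx
  have hPu : lerayProjector d u = u := Lp.ext hae'
  rw [← hPu]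
  exact lerayProjector_apply_mem u

/-! ## `D(A) ⊆ H ∩ H²` -/

/-- **`D(A) ⊆ H²`**: if `(v, w) ∈ stokesGraph d` then `v ∈ H²(T^d; ℝ^d)` spectrally, with
`‖v‖_{H²} ≤ ‖w‖_{L²}`: termwise `(1 + |k|²)² ‖v̂(k)‖² ≤ (4π²|k|²)² ‖v̂(k)‖² = ‖ŵ(k)‖²`
(`Torus.IsStokesImage.mFourierCoeff_eq` of `StokesTorusPositivityProofs`) and Parseval for `w`
(Constantin–Foias 1988, (4.35): `D(A) = H_{2,L} ∩ H`). [cite: ConstantinFoias1988, Ch. 4 (4.35)] -/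
theorem memSobolev_two_of_mem_stokesGraph
    {v w : Lp (EuclideanSpace ℝ d) 2 (volume : Measure (UnitAddTorus d))}
    (h : (v, w) ∈ stokesGraph d) :
    FunctionSpaces.Torus.MemSobolev 2 (FunctionSpaces.EuclideanSpace.complexify ∘ ⇑v) := by
  refine ⟨FunctionSpaces.Torus.integrable_complexify_comp ((Lp.memLp v).integrable one_le_two), ?_⟩
  have hw0 := FunctionSpaces.Torus.memSobolev_zero_complexify (Lp.memLp w)
  refine lt_of_le_of_lt ?_ hw0.2
  unfold FunctionSpaces.Torus.eSobolevNorm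
  refine ENNReal.rpow_le_rpow (ENNReal.tsum_le_tsum fun k => ?_) (by norm_num)
  rw [FunctionSpaces.Torus.sobolevWeight_zero, one_pow, ENNReal.ofReal_one, one_mul,
    sobolevWeight_two, h.2.2.mFourierCoeff_eq h.1 h.2.1 k]
  by_cases hk : k = 0
  · subst hk
    rw [mFourierCoeff_complexify_coe_zero_of_mem h.1]
    simp
  have hr0 := stokesEigenvalue_nonneg k
  have hle := one_add_freqNormSq_le_stokesEigenvalue hk
  have h0 : 0 ≤ 1 + FunctionSpaces.Torus.freqNormSq k := by
    linarith [FunctionSpaces.Torus.freqNormSq_nonneg k]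
  have hr : ‖(stokesEigenvalue k : ℂ)‖ₑ = ENNReal.ofReal (stokesEigenvalue k) := by
    rw [← ofReal_norm, Complex.norm_real, Real.norm_of_nonneg hr0]
  rw [enorm_smul, mul_pow, hr, ← ENNReal.ofReal_pow hr0]
  exact mul_le_mul' (ENNReal.ofReal_le_ofReal (pow_le_pow_left₀ h0 hle 2)) le_rfl

/-! ## `H ∩ H² ⊆ D(A)`: synthesis of `A v` from its coefficients -/

omit [DecidableEq d] in
/-- Fourier coefficients of the conjugate field: `𝓕(conj ∘ f)(k) = conj (𝓕f(-k))`
(Grafakos 2014, Prop. 3.2.6 (4), vector form). [cite: Grafakos2014, Prop. 3.2.6 (4)] -/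
theorem mFourierCoeff_conjVec_comp {f : UnitAddTorus d → EuclideanSpace ℂ d}
    (hf : Integrable f volume) (k : d → ℤ) :
    mFourierCoeff (FunctionSpaces.EuclideanSpace.conjVec ∘ f) k =
      FunctionSpaces.EuclideanSpace.conjVec (mFourierCoeff f (-k)) := by
  rw [FunctionSpaces.Torus.mFourierCoeff_eq_integral_volume,
    FunctionSpaces.Torus.mFourierCoeff_eq_integral_volume, neg_neg]
  have hfun : (fun x => mFourier (-k) x • (FunctionSpaces.EuclideanSpace.conjVec ∘ f) x) =
      fun x => FunctionSpaces.EuclideanSpace.conjVecL (mFourier k x • f x) := by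
    funext x
    rw [FunctionSpaces.EuclideanSpace.conjVecL_apply, FunctionSpaces.EuclideanSpace.conjVec_smul,
      ← mFourier_neg, Function.comp_apply]
  have hint : Integrable (fun x => mFourier k x • f x) volume := by
    simpa only [neg_neg] using FunctionSpaces.Torus.integrable_mFourier_smul' hf (-k)
  rw [hfun, ContinuousLinearMap.integral_comp_comm _ hint,
    FunctionSpaces.EuclideanSpace.conjVecL_apply]

omit [DecidableEq d] in
/-- **Real part of an `L²` field with conjugate-symmetric coefficients**: if `f : T^d → ℂ^d` is
integrable with `f̂ = c` and `c(-k) = conj c(k)`, then the real field `Re f` has the same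
coefficients, `𝓕(complexify ∘ Re f)(k) = ½ (c_k + conj c_{-k}) = c_k` (the reality condition
`ū_k = u_{-k}` of Constantin–Foias 1988, (4.30)/(4.33)).
[cite: ConstantinFoias1988, Ch. 4 (4.33)] -/
theorem mFourierCoeff_complexify_realPart_comp {f : UnitAddTorus d → EuclideanSpace ℂ d}
    (hf : Integrable f volume) {c : (d → ℤ) → EuclideanSpace ℂ d}
    (hc : FunctionSpaces.Torus.IsConjSymm c) (hfc : ∀ k, mFourierCoeff f k = c k) (k : d → ℤ) :
    mFourierCoeff (FunctionSpaces.EuclideanSpace.complexify ∘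
      (⇑FunctionSpaces.EuclideanSpace.realPart ∘ f)) k = c k := by
  have hf' : Integrable (FunctionSpaces.EuclideanSpace.conjVec ∘ f) volume :=
    (FunctionSpaces.EuclideanSpace.conjVecL (ι := d)).integrable_comp hf
  have hfun : (FunctionSpaces.EuclideanSpace.complexify ∘
      (⇑FunctionSpaces.EuclideanSpace.realPart ∘ f)) =
      (2 : ℂ)⁻¹ • (f + FunctionSpaces.EuclideanSpace.conjVec ∘ f) := by
    funext x
    simp only [Function.comp_apply, Pi.smul_apply, Pi.add_apply,
      FunctionSpaces.EuclideanSpace.complexify_realPart_eq]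
  rw [hfun, FunctionSpaces.Torus.mFourierCoeff_const_smul,
    FunctionSpaces.Torus.mFourierCoeff_add hf hf', mFourierCoeff_conjVec_comp hf, hfc, hfc, hc k,
    FunctionSpaces.EuclideanSpace.conjVec_conjVec, ← two_smul ℂ (c k), smul_smul,
    inv_mul_cancel₀ two_ne_zero, one_smul]

omit [DecidableEq d] in
/-- **Riesz–Fischer for real vector fields**: every square-summable conjugate-symmetric family
`c : ℤ^d → ℂ^d` is the coefficient family of a real field `w ∈ L²(T^d; ℝ^d)`, `ŵ = c`
(Grafakos 2014, Prop. 3.2.7 (4), through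
`Torus.exists_memLp_two_forall_mFourierCoeff_eq_of_summable` and
`mFourierCoeff_complexify_realPart_comp`; Constantin–Foias 1988, (4.30): real `u` iff
`ū_k = u_{-k}`). [cite: Grafakos2014, Prop. 3.2.7 (4)] -/
theorem exists_forall_mFourierCoeff_eq_of_isConjSymm {c : (d → ℤ) → EuclideanSpace ℂ d}
    (hc : FunctionSpaces.Torus.IsConjSymm c) (hs : Summable fun k => ‖c k‖ ^ 2) :
    ∃ w : Lp (EuclideanSpace ℝ d) 2 (volume : Measure (UnitAddTorus d)),
      ∀ k, mFourierCoeff (FunctionSpaces.EuclideanSpace.complexify ∘ ⇑w) k = c k := by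
  obtain ⟨f, hf2, hfc⟩ :=
    FunctionSpaces.Torus.exists_memLp_two_forall_mFourierCoeff_eq_of_summable hs
  have hw2 : MemLp (⇑FunctionSpaces.EuclideanSpace.realPart ∘ f) 2 volume :=
    ContinuousLinearMap.comp_memLp' (FunctionSpaces.EuclideanSpace.realPart (ι := d)) hf2
  refine ⟨hw2.toLp _, fun k => ?_⟩
  rw [FunctionSpaces.Torus.mFourierCoeff_congr_ae
      ((hw2.coeFn_toLp).fun_comp FunctionSpaces.EuclideanSpace.complexify) k]
  exact mFourierCoeff_complexify_realPart_comp (hf2.integrable one_le_two) hc hfc k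

/-- **The weak Stokes relation from the coefficient relation**: if `v, w ∈ L²(T^d; ℝ^d)` satisfy
`ŵ(k) = λ_k v̂(k)`, `λ_k = 4π²|k|²`, for all `k`, then `⟪w, g⟫ = -⟪v, Δ g⟫` for every smooth
test field `g` (`Torus.IsStokesImage v w`): both sides are `∑_k λ_k Re ⟪v̂(k), ĝ(k)⟫` by Parseval
(`Torus.hasSum_re_inner_mFourierCoeff_complexify`) and `𝓕(Δ g)(k) = -4π²|k|² ĝ(k)`
(`Torus.mFourierCoeff_complexify_laplacian`) (Constantin–Foias 1988, (4.36): `A = -Δ` on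
coefficients). [cite: ConstantinFoias1988, Ch. 4 (4.36)] -/
theorem isStokesImage_of_mFourierCoeff
    {v w : Lp (EuclideanSpace ℝ d) 2 (volume : Measure (UnitAddTorus d))}
    (h : ∀ k : d → ℤ, mFourierCoeff (FunctionSpaces.EuclideanSpace.complexify ∘ ⇑w) k =
      (stokesEigenvalue k : ℂ) •
        mFourierCoeff (FunctionSpaces.EuclideanSpace.complexify ∘ ⇑v) k) :
    IsStokesImage v w := by
  intro φ ψ g hg _hdiv _hmean hφ hψ
  -- Parseval for both pairings
  have hwg := FunctionSpaces.Torus.hasSum_re_inner_mFourierCoeff_complexify (Lp.memLp w)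
    (hg.memLp 2)
  have hvg := FunctionSpaces.Torus.hasSum_re_inner_mFourierCoeff_complexify (Lp.memLp v)
    (hg.laplacian.memLp 2)
  -- the two coefficient series are opposite termwise
  have hterm : ∀ k : d → ℤ,
      (inner ℂ (mFourierCoeff (FunctionSpaces.EuclideanSpace.complexify ∘ ⇑w) k)
        (mFourierCoeff (FunctionSpaces.EuclideanSpace.complexify ∘ g) k)).re =
        -(inner ℂ (mFourierCoeff (FunctionSpaces.EuclideanSpace.complexify ∘ ⇑v) k)
          (mFourierCoeff (FunctionSpaces.EuclideanSpace.complexify ∘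
            FunctionSpaces.Torus.laplacian g) k)).re := by
    intro k
    rw [h k, FunctionSpaces.Torus.mFourierCoeff_complexify_laplacian hg k, stokesEigenvalue,
      inner_smul_left, inner_neg_right, inner_smul_right, Complex.conj_ofReal, Complex.neg_re,
      neg_neg]
  have hsum : HasSum (fun k : d → ℤ =>
      (inner ℂ (mFourierCoeff (FunctionSpaces.EuclideanSpace.complexify ∘ ⇑w) k)
        (mFourierCoeff (FunctionSpaces.EuclideanSpace.complexify ∘ g) k)).re)
      (-∫ x, inner ℝ (⇑v x) (FunctionSpaces.Torus.laplacian g x)) := by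
    simp_rw [hterm]
    exact hvg.neg
  have heq := hwg.unique hsum
  -- back to `L²` inner products
  rw [MeasureTheory.L2.inner_def, MeasureTheory.L2.inner_def]
  have h1 : ∫ x, ⟪⇑w x, ⇑φ x⟫ = ∫ x, ⟪⇑w x, g x⟫ := by
    refine integral_congr_ae ?_
    filter_upwards [hφ] with x hx
    rw [hx]
  have h2 : ∫ x, ⟪⇑v x, ⇑ψ x⟫ = ∫ x, ⟪⇑v x, FunctionSpaces.Torus.laplacian g x⟫ := by
    refine integral_congr_ae ?_
    filter_upwards [hψ] with x hx
    rw [hx]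
  rw [h1, h2]
  exact heq

omit [DecidableEq d] in
/-- The Stokes eigenvalues are even in the frequency: `λ_{-k} = λ_k`. [folklore] -/
theorem stokesEigenvalue_neg (k : d → ℤ) : stokesEigenvalue (-k) = stokesEigenvalue k := by
  rw [stokesEigenvalue, stokesEigenvalue, FunctionSpaces.Torus.freqNormSq_neg]

omit [DecidableEq d] in
/-- The Stokes coefficient family `k ↦ λ_k v̂(k) = 4π²|k|² v̂(k)` of a real integrable field is
conjugate symmetric (the symbol is real and even). [folklore] -/
theorem isConjSymm_stokesEigenvalue_smul_mFourierCoeff {v : UnitAddTorus d → EuclideanSpace ℝ d}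
    (hv : Integrable v volume) :
    FunctionSpaces.Torus.IsConjSymm fun k : d → ℤ =>
      (stokesEigenvalue k : ℂ) •
        mFourierCoeff (FunctionSpaces.EuclideanSpace.complexify ∘ v) k := by
  intro k
  have hvk := FunctionSpaces.Torus.isConjSymm_mFourierCoeff hv k
  dsimp only at hvk ⊢
  rw [stokesEigenvalue_neg, hvk, FunctionSpaces.EuclideanSpace.conjVec_smul, Complex.conj_ofReal]

omit [DecidableEq d] in
/-- For `v ∈ H²(T^d; ℝ^d)` (spectrally) the Stokes coefficient family `λ_k v̂(k) = 4π²|k|² v̂(k)`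
is square summable: `λ_k² ‖v̂(k)‖² ≤ (4π²)² ⟨k⟩⁴ ‖v̂(k)‖²` and `∑ ⟨k⟩⁴ ‖v̂(k)‖² = ‖v‖²_{H²} < ∞`
(`Torus.MemSobolev.memℓp`). [folklore] -/
theorem summable_sq_norm_stokesEigenvalue_smul_mFourierCoeff
    {v : UnitAddTorus d → EuclideanSpace ℝ d}
    (hv : FunctionSpaces.Torus.MemSobolev 2 (FunctionSpaces.EuclideanSpace.complexify ∘ v)) :
    Summable fun k : d → ℤ =>
      ‖(stokesEigenvalue k : ℂ) •
        mFourierCoeff (FunctionSpaces.EuclideanSpace.complexify ∘ v) k‖ ^ 2 := by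
  have hS : Summable fun k : d → ℤ =>
      ‖((FunctionSpaces.Torus.sobolevWeight 2 k : ℝ) : ℂ) •
        mFourierCoeff (FunctionSpaces.EuclideanSpace.complexify ∘ v) k‖ ^ 2 := by
    have h2 : (0 : ℝ) < (2 : ℝ≥0∞).toReal := by norm_num
    have := (memℓp_gen_iff h2).1 hv.memℓp
    refine this.congr fun k => ?_
    rw [ENNReal.toReal_ofNat, Real.rpow_two]
  refine Summable.of_nonneg_of_le (fun k => sq_nonneg _) (fun k => ?_)
    (hS.mul_left ((4 * Real.pi ^ 2) ^ 2))
  have hr0 := stokesEigenvalue_nonneg k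
  have hn := FunctionSpaces.Torus.freqNormSq_nonneg k
  have hw0 : 0 ≤ 1 + FunctionSpaces.Torus.freqNormSq k := by linarith
  rw [norm_smul, norm_smul, Complex.norm_real, Complex.norm_real, Real.norm_of_nonneg hr0,
    sobolevWeight_two, Real.norm_of_nonneg hw0]
  set n := FunctionSpaces.Torus.freqNormSq k with hn_def
  set x := ‖mFourierCoeff (FunctionSpaces.EuclideanSpace.complexify ∘ v) k‖ with hx_def
  have hx : 0 ≤ x := norm_nonneg _
  calc (stokesEigenvalue k * x) ^ 2 ≤ (4 * Real.pi ^ 2 * (1 + n) * x) ^ 2 :=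
        pow_le_pow_left₀ (mul_nonneg hr0 hx)
          (mul_le_mul_of_nonneg_right (stokesEigenvalue_le_mul_one_add_freqNormSq k) hx) 2
    _ = (4 * Real.pi ^ 2) ^ 2 * ((1 + n) * x) ^ 2 := by ring

/-- **`H ∩ H² ⊆ D(A)`**: for `v ∈ H` with `v ∈ H²` spectrally there is `w ∈ H` with
`(v, w) ∈ stokesGraph d`, namely the real `L²` field with coefficients `ŵ(k) = 4π²|k|² v̂(k)`
(Constantin–Foias 1988, (4.35)–(4.37)): it exists by Riesz–Fischer
(`exists_forall_mFourierCoeff_eq_of_isConjSymm`), lies in `H` by the coefficient criterion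
(`mem_energySpace_of_mFourierCoeff`), and satisfies the weak relation by
`isStokesImage_of_mFourierCoeff`. [cite: ConstantinFoias1988, Ch. 4 (4.35)–(4.37)] -/
theorem exists_mem_stokesGraph_of_memSobolev_two
    {v : Lp (EuclideanSpace ℝ d) 2 (volume : Measure (UnitAddTorus d))}
    (hv : v ∈ FunctionSpaces.Torus.energySpace d)
    (hv2 : FunctionSpaces.Torus.MemSobolev 2 (FunctionSpaces.EuclideanSpace.complexify ∘ ⇑v)) :
    ∃ w : Lp (EuclideanSpace ℝ d) 2 (volume : Measure (UnitAddTorus d)),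
      (v, w) ∈ stokesGraph d := by
  have hvi : Integrable ⇑v volume := (Lp.memLp v).integrable one_le_two
  obtain ⟨w, hw⟩ := exists_forall_mFourierCoeff_eq_of_isConjSymm
    (isConjSymm_stokesEigenvalue_smul_mFourierCoeff hvi)
    (summable_sq_norm_stokesEigenvalue_smul_mFourierCoeff hv2)
  refine ⟨w, hv, ?_, isStokesImage_of_mFourierCoeff hw⟩
  refine mem_energySpace_of_mFourierCoeff ?_ fun k => ?_
  · rw [hw 0]
    simp [stokesEigenvalue]
  · rw [hw k]
    have h1 : ∑ j, (k j : ℂ) *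
        ((stokesEigenvalue k : ℂ) •
          mFourierCoeff (FunctionSpaces.EuclideanSpace.complexify ∘ ⇑v) k) j =
        (stokesEigenvalue k : ℂ) *
          ∑ j, (k j : ℂ) *
            mFourierCoeff (FunctionSpaces.EuclideanSpace.complexify ∘ ⇑v) k j := by
      rw [Finset.mul_sum]
      refine Finset.sum_congr rfl fun j _ => ?_
      rw [PiLp.smul_apply, smul_eq_mul]
      ring
    rw [h1, sum_mul_mFourierCoeff_eq_zero_of_mem_energySpace hv k, mul_zero]

/-! ## The theorem -/

/-- **Domain of the Stokes operator on the flat torus** (discharge of the named fact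
`Torus.stokesOperator_domain_eq`): `D(A) = H ∩ H²(T^d; ℝ^d)`, the real field being complexified
componentwise for the spectral Sobolev predicate `Torus.MemSobolev 2` — as printed in
Constantin–Foias 1988, Ch. 4, periodic case, (4.35): `𝒟(A) = H_{2,L} ∩ V = H_{2,L} ∩ H`, with
`(Au)_k = 4π²L⁻²|k|² u_k` (4.37) (here `L = 1`; the tree's docstring locator "(4.11)" refers to
the same display in a different numbering). The graph-defined operator of `StokesTorus` has
exactly this domain: `memSobolev_two_of_mem_stokesGraph` (`⊆`) and
`exists_mem_stokesGraph_of_memSobolev_two` (`⊇`). [cite: ConstantinFoias1988, Ch. 4 (4.35)] -/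
theorem stokesOperator_domain_eq_holds : stokesOperator_domain_eq (d := d) := by
  unfold stokesOperator_domain_eq
  ext v
  rw [SetLike.mem_coe, LinearPMap.mem_domain_iff, graph_stokesOperator, Set.mem_inter_iff,
    SetLike.mem_coe, Set.mem_setOf_eq]
  constructor
  · rintro ⟨w, hvw⟩
    exact ⟨hvw.1, memSobolev_two_of_mem_stokesGraph hvw⟩
  · rintro ⟨hv, hv2⟩
    exact exists_mem_stokesGraph_of_memSobolev_two hv hv2

/-- Pointwise form (discharge of the companion fact `Torus.mem_domain_stokesOperator_iff`):
`v ∈ D(A) ↔ v ∈ H ∧ v ∈ H²` (Constantin–Foias 1988, Ch. 4, (4.35)).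
[cite: ConstantinFoias1988, Ch. 4 (4.35)] -/
theorem mem_domain_stokesOperator_iff_holds : mem_domain_stokesOperator_iff (d := d) := by
  intro v
  have h := congrArg (v ∈ ·) (stokesOperator_domain_eq_holds (d := d))
  simpa using h

end Torus

end Literature.Analysis.FluidPDE
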